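import Literature.NumberTheory.Automorphic.HarishChandraGLExistence
import Literature.Algebra.Lie.CasimirElement
import Literature.Algebra.Lie.Sl2Strings
import HarnessLib

/-!
# The Casimir element of `𝔤𝔩₂(ℝ)` and its value `-1` at Harish-Chandra parameter `{0, 0}`

Topic `NumberTheory/Automorphic` (archimedean representation theory of `GL₂(ℝ)`; support for the
weight-one dictionary `Literature.NumberTheory.Automorphic.exists_isNewform1_of_isPiOfArtinRep` of
`StrongArtinGL2` through `AutomorphicRepData.IsOfWeightOne`, `StrongArtinGL2WeightOneDictionary`).

The tree expresses the archimedean component of an automorphic representation only through its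
**Harish-Chandra parameter** (`HasHCParameter`, `HarishChandraGL`: an infinitesimal character
`θ : Z(𝔤) → ℂ` with `θ(z) = γ(z)(χ)` for the Harish-Chandra homomorphism `γ`, which exists and is
unique — `nonempty_harishChandraHomGL_holds`, `harishChandraHomGL_unique_holds`).  To use such a
hypothesis in the classical `(𝔤, K)`-module calculus for `GL₂(ℝ)` (Bump, *Automorphic Forms and
Representations* (1997), §2.2–2.5) one needs the value of `θ` on the **Casimir element**.  This
file supplies it for `𝔤𝔩₂(ℝ)`:

* `GL2Real.X₁ = diag(1,-1)`, `X₂ = (0 1; 1 0)`, `W = (0 1; -1 0)` (Bump (2.18)), `E₁₂`, `E₂₁`,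
  their products and brackets, and `decompose` (`1, X₁, X₂, W` span `𝔤𝔩₂(ℝ)`).
* `GL2Real.casimir = X₁² + X₂² - W² ∈ U(𝔤𝔩₂(ℝ))` (real enveloping algebra; `= 2Ω` for the
  trace-form Casimir `Ω = ½h² + ef + fe` of `𝔰𝔩₂`, Knapp 2002, (5.24)) and
  `casimir_mem_center` (**central**, from the three bracket relations and
  `Literature.Algebra.Lie.mem_center_of_forall_ι_comm`).
* `lift_casimir` (`C ↦ ρ(X₁)² + ρ(X₂)² - ρ(W)²` in any module),
  `lift_casimir_apply_of_isHighestWeightVector` (**`C = m² + 2m` on a highest weight vector**,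
  `m = l₀ - l₁`), `aeval_harishChandra_casimir` (**`γ(C)(x) = (x₀ - x₁)² - 1`**, evaluated
  through the axiom `HarishChandraHomGL.highestWeight` on the model `HCModel.modelRep` of
  `HarishChandraGLModel`, highest weight `x - ρ`, `ρ = (½, -½)`).
* `lift_casimir_eq_neg_one_of_hasHCParameter` — **at Harish-Chandra parameter `{0, 0}`
  (`π(1, sgn)`, `π(1, 1)`, `π(sgn, sgn)`), `C` acts by `γ(C)(0,0) = -1`**, i.e.
  `ρ(X₁)² + ρ(X₂)² - ρ(W)² = -1` (`sq_add_sq_sub_sq_eq_neg_one_of_hasHCParameter`).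
* The compact `sl₂`-triple `H = -i ρ(W)`, `R = ½(ρ(X₁) + i ρ(X₂))`, `L = ½(ρ(X₁) - i ρ(X₂))`
  (Bump (2.23); `H` has the `SO(2)`-types as eigenvalues, `R`/`L` raise/lower them by `2`):
  `lie_H_R`, `lie_H_L`, `lie_R_L`, `isSl2Triple` (Mathlib's `IsSl2Triple`, given `H ≠ 0`),
  `sl2Casimir_eq_lift_casimir` (**`4LR + H² + 2H = C`**, the operator `casimir H R L` of
  `Literature/Algebra/Lie/Sl2Strings`; `= -4Δ` for Bump's `Δ`, Prop. 2.2.5), and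
  `sl2Casimir_apply_of_hasHCParameter`: **at parameter `{0,0}`, `4LR + H² + 2H = -1`** — Bump's
  `λ = ¼ = k/2(1 - k/2)` with `k = 1` (Thm. 2.5.4 (ii): the case of the limits of discrete series
  `𝒟^±(1)`; Gelbart 1997, Concluding Remark (1): eigenvalue `¼`), which is exactly the hypothesis
  of the weight-one lemmas of `Literature/Algebra/Lie/Sl2WeightOne`.

Everything is proved; the definitions are the five matrices, `casimir` and the three operators
`H`, `R`, `L`; no named fact.

## Mathlib / Literature search

Reused from the tree: `HasHCParameter`, `HarishChandraHomGL` (+ `.highestWeight`, `.symmetric`),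
`IsHighestWeightVector`, `weightFun`, `rhoGL`, `upperNilpLie` (`HarishChandraGL`),
`nonempty_harishChandraHomGL_holds` (`HarishChandraGLExistence`), `HCModel.modelRep`, `hwVec`,
`isHighestWeightVector_hwVec` (`HarishChandraGLModel`), `mem_center_of_forall_ι_comm`
(`Literature/Algebra/Lie/CasimirElement`), `Sl2.casimir` (`Sl2Strings`).  From Mathlib:
`UniversalEnvelopingAlgebra.lift`, `IsSl2Triple`, `noncomm_ring`, `match_scalars`.  The tree's
Casimirs (`CasimirElement.casimirElement` for a non-degenerate invariant form, the `tr(𝔼^k)` of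
`HarishChandraCore`) are not specialised to `𝔤𝔩₂(ℝ)` anywhere, and no value of `γ` at a
non-trivial parameter was computed before (`hasHCParameter_trivial_holds` is the parameter `ρ` of
the trivial module); `lean search 'GL2Real|casimir.*neg_one|weightOne.*Casimir'`: no hits.

## References

* D. Bump, *Automorphic Forms and Representations*, Cambridge Stud. Adv. Math. 55 (1997), §2.2,
  (2.18)–(2.23), Prop. 2.2.5; §2.5, Thm. 2.5.3, Thm. 2.5.4 (held text
  `book:bump1997-automorphic-forms-representations`, chunks 195–206). [Bump1997]
* A. W. Knapp, *Lie Groups Beyond an Introduction*, 2nd ed. (2002), V.§4 (5.24), V.§5 (5.43),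
  Thm. 5.44. [Knapp2002]
* S. Gelbart, *Three lectures …* (1997), Remark 2.5.2, Concluding Remark (1) after Prop. 4.2.
  [Gelbart1997]
-/

-- Mathlib idiom (Mathlib/Algebra/Lie/OfAssociative.lean); commutator brackets on matrices / `End V`
attribute [local instance 100] LieRing.ofAssociativeRing

open scoped Matrix

noncomputable section

namespace Literature.NumberTheory.Automorphic

namespace GL2Real

/-! ### The basis `1, X₁, X₂, W` of `𝔤𝔩₂(ℝ)` -/

/-- `X₁ = diag(1, -1)`, the split Cartan generator `H` of `𝔰𝔩₂(ℝ)` (Bump 1997, (2.18)). [folklore] -/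
def X₁ : Matrix (Fin 2) (Fin 2) ℝ := !![1, 0; 0, -1]

/-- `X₂ = (0 1; 1 0) = E₁₂ + E₂₁`. [folklore] -/
def X₂ : Matrix (Fin 2) (Fin 2) ℝ := !![0, 1; 1, 0]

/-- `W = (0 1; -1 0) = E₁₂ - E₂₁`, the infinitesimal generator of `SO(2)`:
`exp (θ W) = (cos θ, sin θ; -sin θ, cos θ)` (Bump 1997, (2.18): `W`). [folklore] -/
def W : Matrix (Fin 2) (Fin 2) ℝ := !![0, 1; -1, 0]

/-- `E₁₂`, the raising root vector of the upper triangular Borel. [folklore] -/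
def E₁₂ : Matrix (Fin 2) (Fin 2) ℝ := !![0, 1; 0, 0]

/-- `E₂₁`, the lowering root vector. [folklore] -/
def E₂₁ : Matrix (Fin 2) (Fin 2) ℝ := !![0, 0; 1, 0]

/-- `X₁ = diag(1, -1)`. [folklore] -/
theorem X₁_eq_diagonal : X₁ = Matrix.diagonal ![1, -1] := by
  ext i j; fin_cases i <;> fin_cases j <;> simp [X₁]

/-- `X₂ = E₁₂ + E₂₁`. [folklore] -/
theorem X₂_eq : X₂ = E₁₂ + E₂₁ := by
  ext i j; fin_cases i <;> fin_cases j <;> simp [X₂, E₁₂, E₂₁]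

/-- `W = E₁₂ - E₂₁`. [folklore] -/
theorem W_eq : W = E₁₂ - E₂₁ := by
  ext i j; fin_cases i <;> fin_cases j <;> simp [W, E₁₂, E₂₁]

/-- `E₁₂` is strictly upper triangular. [folklore] -/
theorem E₁₂_mem_upperNilpLie : E₁₂ ∈ upperNilpLie ℝ 2 := by
  intro i j hji
  fin_cases i <;> fin_cases j <;> simp [E₁₂] at hji ⊢

/-- `[E₁₂, E₂₁] = diag(1, -1) = X₁`. [folklore] -/
theorem lie_E₁₂_E₂₁ : ⁅E₁₂, E₂₁⁆ = X₁ := by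
  rw [Ring.lie_def]
  ext i j; fin_cases i <;> fin_cases j <;> simp [X₁, E₁₂, E₂₁]

/-- `X₁² = 1`. [folklore] -/
theorem X₁_mul_X₁ : X₁ * X₁ = 1 := by
  ext i j; fin_cases i <;> fin_cases j <;> simp [X₁]

/-- `X₂² = 1`. [folklore] -/
theorem X₂_mul_X₂ : X₂ * X₂ = 1 := by
  ext i j; fin_cases i <;> fin_cases j <;> simp [X₂]

/-- `W² = -1`. [folklore] -/
theorem W_mul_W : W * W = -1 := by
  ext i j; fin_cases i <;> fin_cases j <;> simp [W]

/-- `X₁ X₂ = W`. [folklore] -/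
theorem X₁_mul_X₂ : X₁ * X₂ = W := by
  ext i j; fin_cases i <;> fin_cases j <;> simp [X₁, X₂, W]

/-- `X₂ X₁ = -W`. [folklore] -/
theorem X₂_mul_X₁ : X₂ * X₁ = -W := by
  ext i j; fin_cases i <;> fin_cases j <;> simp [X₁, X₂, W]

/-- `X₁ W = X₂`. [folklore] -/
theorem X₁_mul_W : X₁ * W = X₂ := by
  ext i j; fin_cases i <;> fin_cases j <;> simp [X₁, X₂, W]

/-- `W X₁ = -X₂`. [folklore] -/
theorem W_mul_X₁ : W * X₁ = -X₂ := by
  ext i j; fin_cases i <;> fin_cases j <;> simp [X₁, X₂, W]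

/-- `X₂ W = -X₁`. [folklore] -/
theorem X₂_mul_W : X₂ * W = -X₁ := by
  ext i j; fin_cases i <;> fin_cases j <;> simp [X₁, X₂, W]

/-- `W X₂ = X₁`. [folklore] -/
theorem W_mul_X₂ : W * X₂ = X₁ := by
  ext i j; fin_cases i <;> fin_cases j <;> simp [X₁, X₂, W]

/-- `[X₁, X₂] = 2 W`. [folklore] -/
theorem lie_X₁_X₂ : ⁅X₁, X₂⁆ = (2 : ℝ) • W := by
  rw [Ring.lie_def, X₁_mul_X₂, X₂_mul_X₁, sub_neg_eq_add, two_smul]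

/-- `[X₁, W] = 2 X₂`. [folklore] -/
theorem lie_X₁_W : ⁅X₁, W⁆ = (2 : ℝ) • X₂ := by
  rw [Ring.lie_def, X₁_mul_W, W_mul_X₁, sub_neg_eq_add, two_smul]

/-- `[X₂, W] = -2 X₁`. [folklore] -/
theorem lie_X₂_W : ⁅X₂, W⁆ = -((2 : ℝ) • X₁) := by
  rw [Ring.lie_def, X₂_mul_W, W_mul_X₂, two_smul, neg_add, sub_eq_add_neg]

/-- **`1, X₁, X₂, W` span `𝔤𝔩₂(ℝ)`**:
`M = ½(a + d)·1 + ½(a - d) X₁ + ½(b + c) X₂ + ½(b - c) W` for `M = (a b; c d)`. [folklore] -/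
theorem decompose (M : Matrix (Fin 2) (Fin 2) ℝ) :
    M = ((M 0 0 + M 1 1) / 2) • (1 : Matrix (Fin 2) (Fin 2) ℝ) + ((M 0 0 - M 1 1) / 2) • X₁ +
      ((M 0 1 + M 1 0) / 2) • X₂ + ((M 0 1 - M 1 0) / 2) • W := by
  ext i j
  fin_cases i <;> fin_cases j <;> simp [X₁, X₂, W] <;> ring

/-! ### The Casimir element `C = X₁² + X₂² - W²` of `U(𝔤𝔩₂(ℝ))` -/

open UniversalEnvelopingAlgebra in
/-- **The Casimir element `C = X₁² + X₂² - W² ∈ U(𝔤𝔩₂(ℝ))`** (real enveloping algebra).  In terms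
of the standard basis `h = X₁`, `e = E₁₂ = ½(X₂ + W)`, `f = E₂₁ = ½(X₂ - W)` of `𝔰𝔩₂`:
`C = h² + 2(ef + fe) = 2Ω` for the Casimir element `Ω = ½h² + ef + fe` of the trace form on `𝔰𝔩₂`
(Knapp 2002, (5.24)); through the compact triple `H = -iW`, `R = ½(X₁ + iX₂)`, `L = ½(X₁ - iX₂)`
it acts in every module as `4LR + H² + 2H` (`lift_casimir_eq_sl2Casimir` below), i.e. as the
operator `casimir H R L` of `Literature/Algebra/Lie/Sl2Strings`, and as `-4Δ` for Bump's
`Δ = -¼(H² + 2RL + 2LR)` (Bump 1997, Prop. 2.2.5, Thm. 2.5.3: `Δ = λ = k/2 (1 - k/2)` on the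
weight-`k` discrete series, so `C = k² - 2k`; `C = -1` exactly for `k = 1`, `λ = ¼`).
[cite: Bump1997, Prop. 2.2.5 and Thm. 2.5.3] -/
def casimir : UniversalEnvelopingAlgebra ℝ (Matrix (Fin 2) (Fin 2) ℝ) :=
  ι ℝ X₁ * ι ℝ X₁ + ι ℝ X₂ * ι ℝ X₂ - ι ℝ W * ι ℝ W

open UniversalEnvelopingAlgebra in
/-- The bracket relations of `X₁, X₂, W` in `U(𝔤𝔩₂(ℝ))`. [folklore] -/
theorem ι_rel :
    ι ℝ X₁ * ι ℝ X₂ - ι ℝ X₂ * ι ℝ X₁ = 2 * ι ℝ W ∧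
    ι ℝ X₁ * ι ℝ W - ι ℝ W * ι ℝ X₁ = 2 * ι ℝ X₂ ∧
    ι ℝ X₂ * ι ℝ W - ι ℝ W * ι ℝ X₂ = -(2 * ι ℝ X₁) := by
  have h2 : ∀ Y : Matrix (Fin 2) (Fin 2) ℝ,
      ι ℝ ((2 : ℝ) • Y) = 2 * (ι ℝ Y : UniversalEnvelopingAlgebra ℝ (Matrix (Fin 2) (Fin 2) ℝ)) := by
    intro Y
    rw [map_smul, Algebra.smul_def, map_ofNat]
  refine ⟨?_, ?_, ?_⟩
  · rw [← LieRing.of_associative_ring_bracket, ← LieHom.map_lie, lie_X₁_X₂, h2]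
  · rw [← LieRing.of_associative_ring_bracket, ← LieHom.map_lie, lie_X₁_W, h2]
  · rw [← LieRing.of_associative_ring_bracket, ← LieHom.map_lie, lie_X₂_W, map_neg, h2]

open UniversalEnvelopingAlgebra in
/-- `ι 1` is central in `U(𝔤𝔩₂(ℝ))` (`1` is central in `𝔤𝔩₂`). [folklore] -/
theorem ι_one_mem_center :
    (ι ℝ (1 : Matrix (Fin 2) (Fin 2) ℝ) : UniversalEnvelopingAlgebra ℝ (Matrix (Fin 2) (Fin 2) ℝ)) ∈
      Subalgebra.center ℝ (UniversalEnvelopingAlgebra ℝ (Matrix (Fin 2) (Fin 2) ℝ)) := by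
  refine Literature.Algebra.Lie.mem_center_of_forall_ι_comm fun Y ↦ ?_
  have h : ι ℝ Y * ι ℝ (1 : Matrix (Fin 2) (Fin 2) ℝ) - ι ℝ 1 * ι ℝ Y =
      (0 : UniversalEnvelopingAlgebra ℝ (Matrix (Fin 2) (Fin 2) ℝ)) := by
    rw [← LieRing.of_associative_ring_bracket, ← LieHom.map_lie, Ring.lie_def, mul_one, one_mul,
      sub_self, map_zero]
  exact (sub_eq_zero.1 h)

open UniversalEnvelopingAlgebra in
/-- **The Casimir element is central in `U(𝔤𝔩₂(ℝ))`** (Knapp 2002, Prop. 5.24; here by the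
three bracket relations: e.g. `[X₁, C] = ([X₁,X₂]X₂ + X₂[X₁,X₂]) - ([X₁,W]W + W[X₁,W])
= 2(WX₂ + X₂W) - 2(X₂W + WX₂) = 0`, and `1, X₁, X₂, W` span `𝔤𝔩₂`). [cite: Knapp2002, Prop. 5.24] -/
theorem casimir_mem_center :
    casimir ∈ Subalgebra.center ℝ (UniversalEnvelopingAlgebra ℝ (Matrix (Fin 2) (Fin 2) ℝ)) := by
  obtain ⟨hab, hac, hbc⟩ := ι_rel
  set a := (ι ℝ X₁ : UniversalEnvelopingAlgebra ℝ (Matrix (Fin 2) (Fin 2) ℝ)) with ha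
  set b := (ι ℝ X₂ : UniversalEnvelopingAlgebra ℝ (Matrix (Fin 2) (Fin 2) ℝ)) with hb
  set c := (ι ℝ W : UniversalEnvelopingAlgebra ℝ (Matrix (Fin 2) (Fin 2) ℝ)) with hc
  have hC : casimir = a * a + b * b - c * c := rfl
  -- commutation with the three generators
  have h1 : a * casimir = casimir * a := by
    rw [← sub_eq_zero, hC]
    calc a * (a * a + b * b - c * c) - (a * a + b * b - c * c) * a
        = (a * b - b * a) * b + b * (a * b - b * a) - ((a * c - c * a) * c + c * (a * c - c * a)) := by
          noncomm_ring
      _ = 0 := by rw [hab, hac]; noncomm_ring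
  have h2 : b * casimir = casimir * b := by
    rw [← sub_eq_zero, hC]
    have hba : b * a - a * b = -(2 * c) := by rw [← neg_sub, hab]
    calc b * (a * a + b * b - c * c) - (a * a + b * b - c * c) * b
        = (b * a - a * b) * a + a * (b * a - a * b) - ((b * c - c * b) * c + c * (b * c - c * b)) := by
          noncomm_ring
      _ = 0 := by rw [hba, hbc]; noncomm_ring
  have h3 : c * casimir = casimir * c := by
    rw [← sub_eq_zero, hC]
    have hca : c * a - a * c = -(2 * b) := by rw [← neg_sub, hac]
    have hcb : c * b - b * c = 2 * a := by rw [← neg_sub, hbc, neg_neg]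
    calc c * (a * a + b * b - c * c) - (a * a + b * b - c * c) * c
        = (c * a - a * c) * a + a * (c * a - a * c) + ((c * b - b * c) * b + b * (c * b - b * c)) := by
          noncomm_ring
      _ = 0 := by rw [hca, hcb]; noncomm_ring
  have h0 : ι ℝ (1 : Matrix (Fin 2) (Fin 2) ℝ) * casimir = casimir * ι ℝ 1 :=
    (Subalgebra.mem_center_iff.1 ι_one_mem_center casimir).symm
  refine Literature.Algebra.Lie.mem_center_of_forall_ι_comm fun Y ↦ ?_
  conv_lhs => rw [decompose Y]
  conv_rhs => rw [decompose Y]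
  simp only [map_add, map_smul, add_mul, mul_add, smul_mul_assoc, mul_smul_comm,
    ← ha, ← hb, ← hc, h0, h1, h2, h3]

/-! ### The action of `C` in a module -/

variable {V : Type*} [AddCommGroup V] [Module ℂ V]
  (ρ : Matrix (Fin 2) (Fin 2) ℝ →ₗ⁅ℝ⁆ Module.End ℂ V)

/-- In any module, `C` acts as `ρ(X₁)² + ρ(X₂)² - ρ(W)²`. [folklore] -/
theorem lift_casimir :
    UniversalEnvelopingAlgebra.lift ℝ ρ casimir = ρ X₁ * ρ X₁ + ρ X₂ * ρ X₂ - ρ W * ρ W := by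
  simp only [casimir, map_sub, map_add, map_mul, UniversalEnvelopingAlgebra.lift_ι_apply]

/-- **`C` on a highest weight vector.** If `v` is a highest weight vector of weight `l` (upper
triangular Borel), then `C v = (m² + 2m) v` with `m = l(diag(1, -1)) = l₀ - l₁`:
`X₁ v = m v`, and `X₂² - W² = 2(E₁₂E₂₁ + E₂₁E₁₂)` acts by `2 E₁₂E₂₁ v = 2 [E₁₂, E₂₁] v = 2m v`.
(Knapp 2002, §V.5, (5.43): the action of `Z(𝔤)` on highest weight vectors.) [cite: Knapp2002, §V.5 (5.43)] -/
theorem lift_casimir_apply_of_isHighestWeightVector {l : ArchWeightGL ℝ 2} {v : V}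
    (hv : IsHighestWeightVector ρ l v) :
    UniversalEnvelopingAlgebra.lift ℝ ρ casimir v =
      (weightFun l ![1, -1] * weightFun l ![1, -1] + 2 * weightFun l ![1, -1]) • v := by
  obtain ⟨-, hN, hH⟩ := hv
  set m : ℂ := weightFun l ![1, -1] with hm
  have hX₁ : ρ X₁ v = m • v := by rw [X₁_eq_diagonal, hH]
  have hE₁₂ : ρ E₁₂ v = 0 := hN _ E₁₂_mem_upperNilpLie
  have hcomm : ρ E₁₂ (ρ E₂₁ v) = m • v := by
    have h := LieHom.map_lie ρ E₁₂ E₂₁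
    rw [lie_E₁₂_E₂₁, LieRing.of_associative_ring_bracket] at h
    have h' := LinearMap.congr_fun h v
    simp only [LinearMap.sub_apply, Module.End.mul_apply, hE₁₂, map_zero, sub_zero] at h'
    rw [← h', hX₁]
  rw [lift_casimir, X₂_eq, W_eq, map_add, map_sub]
  simp only [LinearMap.sub_apply, LinearMap.add_apply, Module.End.mul_apply, hX₁, map_smul, hE₁₂,
    zero_add, zero_sub, map_neg, hcomm]
  module

/-- The unique real-algebra embedding `ℝ → ℂ` acts as the coercion. [folklore] -/
theorem algHom_real_apply (τ : ℝ →ₐ[ℝ] ℂ) (r : ℝ) : τ r = (r : ℂ) := by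
  simpa using τ.commutes r

/-- `l(diag(1, -1)) = l₀ - l₁` for a weight `l` of `𝔤𝔩₂(ℝ)` (one embedding `τ`). [folklore] -/
theorem weightFun_one_neg_one (l : ArchWeightGL ℝ 2) :
    weightFun l ![1, -1] = l default 0 - l default 1 := by
  rw [weightFun, Fintype.sum_unique, Fin.sum_univ_two]
  simp [algHom_real_apply, sub_eq_add_neg]

/-- **The Harish-Chandra image of `C`: `γ(C)(x) = (x₀ - x₁)² - 1`.**  Evaluate `γ(C)` at `x`
through the axiom `HarishChandraHomGL.highestWeight` on the highest weight vector of weight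
`λ = x - ρ` (`ρ = (½, -½)`) of the model `HCModel.modelRep` (`HarishChandraGLModel`): there `C`
acts by `m² + 2m` with `m = λ₀ - λ₁ = (x₀ - x₁) - 1` (`lift_casimir_apply_of_isHighestWeightVector`),
and `(d - 1)² + 2(d - 1) = d² - 1`.  In particular `γ(C)(0, 0) = -1` and `γ(C)(ρ) = 0` (trivial
representation). Knapp 2002, Thm. 5.44. [cite: Knapp2002, Thm. 5.44] -/
theorem aeval_harishChandra_casimir (γ : HarishChandraHomGL ℝ 2) (x : (ℝ →ₐ[ℝ] ℂ) × Fin 2 → ℂ) :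
    MvPolynomial.aeval x (γ.toAlgHom ⟨casimir, casimir_mem_center⟩) =
      (x (default, 0) - x (default, 1)) ^ 2 - 1 := by
  -- the highest weight `λ = x - ρ`
  set l : ArchWeightGL ℝ 2 := fun τ i ↦ x (τ, i) - rhoGL 2 i with hl
  have key := γ.highestWeight (HCModel.ModelSpace ℝ 2) (HCModel.modelRep ℝ 2).rho l
    (HCModel.hwVec l) (HCModel.isHighestWeightVector_hwVec l) ⟨casimir, casimir_mem_center⟩
  have hx : (fun p : (ℝ →ₐ[ℝ] ℂ) × Fin 2 ↦ l p.1 p.2 + rhoGL 2 p.2) = x := by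
    funext ⟨τ, i⟩; simp [hl]
  rw [hx] at key
  change UniversalEnvelopingAlgebra.lift ℝ (HCModel.modelRep ℝ 2).rho casimir (HCModel.hwVec l) = _
    at key
  rw [lift_casimir_apply_of_isHighestWeightVector _ (HCModel.isHighestWeightVector_hwVec l)] at key
  have hne : HCModel.hwVec l ≠ (0 : HCModel.ModelSpace ℝ 2) :=
    (HCModel.isHighestWeightVector_hwVec (𝕜 := ℝ) l).1
  have heq := sub_eq_zero.2 key
  rw [← sub_smul, smul_eq_zero] at heq
  have hval := sub_eq_zero.1 (heq.resolve_right hne)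
  have hw : weightFun l ![1, -1] = (x (default, 0) - x (default, 1)) - 1 := by
    rw [weightFun_one_neg_one]
    simp only [hl, rhoGL, Fin.val_zero, Fin.val_one, Nat.cast_zero, Nat.cast_one, Nat.cast_ofNat]
    ring
  rw [← hval, hw]
  ring

/-- **`C` acts by `-1` on every `𝔤𝔩₂(ℝ)`-module of Harish-Chandra parameter `{0, 0}`** — the
infinitesimal character of `π(1, sgn)` (and of `π(1,1)`, `π(sgn, sgn)`): the parameter gives a
central character `θ` with `θ(C) = γ(C)(0, 0) = -1` (`aeval_harishChandra_casimir`, the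
Harish-Chandra homomorphism existing by `nonempty_harishChandraHomGL_holds`).  Equivalently
Bump's `Δ` acts by `λ = ¼` (Bump 1997, Thm. 2.5.4 (ii) with `k = 1`; Gelbart 1997, Concluding
Remark (1): "Maass forms of eigenvalue `¼`" in the even case). [cite: Bump1997, Thm. 2.5.4 (ii)]
[cite: Knapp2002, Thm. 5.44] -/
theorem lift_casimir_eq_neg_one_of_hasHCParameter
    (h : HasHCParameter ρ fun _ ↦ ({0, 0} : Multiset ℂ)) :
    UniversalEnvelopingAlgebra.lift ℝ ρ casimir = -1 := by
  obtain ⟨-, θ, hθ, hγ⟩ := h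
  obtain ⟨γ⟩ := (nonempty_harishChandraHomGL_holds ℝ 2 : nonempty_harishChandraHomGL ℝ 2)
  -- the enumeration `l ≡ 0` of the parameter `{0, 0}`
  have hl : ∀ τ : ℝ →ₐ[ℝ] ℂ, Finset.univ.val.map ((fun (_ : ℝ →ₐ[ℝ] ℂ) (_ : Fin 2) ↦ (0 : ℂ)) τ) =
      ({0, 0} : Multiset ℂ) := by
    intro τ
    rw [Multiset.map_const', Finset.card_val, Finset.card_univ, Fintype.card_fin]
    rfl
  have h1 := hγ γ (fun _ _ ↦ 0) hl ⟨casimir, casimir_mem_center⟩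
  rw [aeval_harishChandra_casimir] at h1
  simp only [sub_self, ne_eq, OfNat.ofNat_ne_zero, not_false_eq_true, zero_pow, zero_sub] at h1
  have h2 := hθ ⟨casimir, casimir_mem_center⟩
  rw [h1, map_neg, map_one] at h2
  exact h2

/-- Unfolded form: `ρ(X₁)² + ρ(X₂)² - ρ(W)² = -1` at Harish-Chandra parameter `{0, 0}`. [folklore] -/
theorem sq_add_sq_sub_sq_eq_neg_one_of_hasHCParameter
    (h : HasHCParameter ρ fun _ ↦ ({0, 0} : Multiset ℂ)) :
    ρ X₁ * ρ X₁ + ρ X₂ * ρ X₂ - ρ W * ρ W = -1 := by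
  rw [← lift_casimir, lift_casimir_eq_neg_one_of_hasHCParameter ρ h]

/-! ### The compact `sl₂`-triple `H = -iW`, `R = ½(X₁ + iX₂)`, `L = ½(X₁ - iX₂)` -/

/-- The weight operator `H = -i ρ(W)` of `SO(2)` (`H φ = k φ` for `φ(g r(θ)) = e^{-ikθ} φ(g)`,
`r(θ) = exp(-θ W)`; Bump 1997, (2.18)–(2.23)). [cite: Bump1997, (2.18)–(2.23)] -/
def H : Module.End ℂ V := (-Complex.I) • ρ W

/-- The raising operator `R = ½(ρ(X₁) + i ρ(X₂))` (Bump 1997, (2.23)). [cite: Bump1997, (2.23)] -/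
def R : Module.End ℂ V := (1 / 2 : ℂ) • (ρ X₁ + Complex.I • ρ X₂)

/-- The lowering operator `L = ½(ρ(X₁) - i ρ(X₂))` (Bump 1997, (2.23); Gelbart's `X` up to the
factor `½`: `(i 1; 1 -i) = i (X₁ - iX₂)`). [cite: Bump1997, (2.23)] -/
def L : Module.End ℂ V := (1 / 2 : ℂ) • (ρ X₁ - Complex.I • ρ X₂)

/-- The bracket relations of `ρ(X₁), ρ(X₂), ρ(W)` in `End V`. [folklore] -/
theorem ρ_rel :
    ρ X₁ * ρ X₂ - ρ X₂ * ρ X₁ = (2 : ℂ) • ρ W ∧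
    ρ X₁ * ρ W - ρ W * ρ X₁ = (2 : ℂ) • ρ X₂ ∧
    ρ X₂ * ρ W - ρ W * ρ X₂ = -((2 : ℂ) • ρ X₁) := by
  have h2 : ∀ Y : Matrix (Fin 2) (Fin 2) ℝ, ρ ((2 : ℝ) • Y) = (2 : ℂ) • ρ Y := by
    intro Y
    rw [map_smul, ← Complex.coe_smul]
    norm_num
  refine ⟨?_, ?_, ?_⟩
  · rw [← LieRing.of_associative_ring_bracket, ← LieHom.map_lie, lie_X₁_X₂, h2]
  · rw [← LieRing.of_associative_ring_bracket, ← LieHom.map_lie, lie_X₁_W, h2]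
  · rw [← LieRing.of_associative_ring_bracket, ← LieHom.map_lie, lie_X₂_W, map_neg, h2]

/-- `[H, R] = 2R`. [cite: Bump1997, Prop. 2.2.5] -/
theorem lie_H_R : ⁅H ρ, R ρ⁆ = 2 • R ρ := by
  obtain ⟨-, hac, hbc⟩ := ρ_rel ρ
  rw [LieRing.of_associative_ring_bracket, H, R]
  have hca : ρ W * ρ X₁ = ρ X₁ * ρ W - (2 : ℂ) • ρ X₂ := by rw [← hac]; abel
  have hcb : ρ W * ρ X₂ = ρ X₂ * ρ W + (2 : ℂ) • ρ X₁ := by rw [← sub_eq_iff_eq_add', ← neg_sub, hbc, neg_neg]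
  simp only [smul_add, smul_mul_assoc, mul_smul_comm, mul_add, add_mul, smul_smul, hca, hcb,
    smul_sub]
  match_scalars <;> (ring_nf; try simp only [Complex.I_sq, neg_neg])

/-- `[H, L] = -2L`. [cite: Bump1997, Prop. 2.2.5] -/
theorem lie_H_L : ⁅H ρ, L ρ⁆ = -(2 • L ρ) := by
  obtain ⟨-, hac, hbc⟩ := ρ_rel ρ
  rw [LieRing.of_associative_ring_bracket, H, L]
  have hca : ρ W * ρ X₁ = ρ X₁ * ρ W - (2 : ℂ) • ρ X₂ := by rw [← hac]; abel
  have hcb : ρ W * ρ X₂ = ρ X₂ * ρ W + (2 : ℂ) • ρ X₁ := by rw [← sub_eq_iff_eq_add', ← neg_sub, hbc, neg_neg]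
  simp only [smul_add, smul_mul_assoc, mul_smul_comm, smul_smul, hca, hcb,
    smul_sub, mul_sub, sub_mul]
  match_scalars <;> (ring_nf; try simp only [Complex.I_sq])

/-- `[R, L] = H`. [cite: Bump1997, Prop. 2.2.5] -/
theorem lie_R_L : ⁅R ρ, L ρ⁆ = H ρ := by
  obtain ⟨hab, -, -⟩ := ρ_rel ρ
  rw [LieRing.of_associative_ring_bracket, H, R, L]
  have hba : ρ X₂ * ρ X₁ = ρ X₁ * ρ X₂ - (2 : ℂ) • ρ W := by rw [← hab]; abel
  simp only [smul_add, smul_sub, smul_mul_assoc, mul_smul_comm, mul_add, add_mul, mul_sub, sub_mul,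
    smul_smul, hba]
  match_scalars <;> (ring_nf; try simp only [Complex.I_sq, neg_neg])

/-- **`(H, R, L)` is an `sl₂`-triple in `End V` as soon as `H ≠ 0`** (Mathlib's `IsSl2Triple`
records `h ≠ 0`; in a module with a vector of non-zero `SO(2)`-weight this holds).
[cite: Bump1997, Prop. 2.2.5] -/
theorem isSl2Triple (hH : H ρ ≠ 0) : IsSl2Triple (H ρ) (R ρ) (L ρ) where
  h_ne_zero := hH
  lie_e_f := lie_R_L ρ
  lie_h_e_nsmul := lie_H_R ρ
  lie_h_f_nsmul := lie_H_L ρ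

/-- **The Casimir operator of the compact triple is the action of `C`**:
`4LR + H² + 2H = ρ(X₁)² + ρ(X₂)² - ρ(W)²` (`= -4Δ`, Bump 1997, Prop. 2.2.5).
[cite: Bump1997, Prop. 2.2.5] -/
theorem sl2Casimir_eq_lift_casimir :
    Literature.Algebra.Lie.Sl2.casimir (H ρ) (R ρ) (L ρ) =
      UniversalEnvelopingAlgebra.lift ℝ ρ casimir := by
  obtain ⟨hab, -, -⟩ := ρ_rel ρ
  rw [lift_casimir, Literature.Algebra.Lie.Sl2.casimir, H, R, L]
  have hba : ρ X₂ * ρ X₁ = ρ X₁ * ρ X₂ - (2 : ℂ) • ρ W := by rw [← hab]; abel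
  simp only [smul_add, smul_sub, smul_mul_assoc, mul_smul_comm, mul_add, sub_mul,
    smul_smul, hba]
  match_scalars <;> (ring_nf; try simp only [Complex.I_sq, neg_neg])

/-- Hence **at Harish-Chandra parameter `{0, 0}` the Casimir operator of the compact triple is
`-1`**: `4LR + H² + 2H = -1` on `V` (Bump: `Δ = ¼`), the hypothesis of the weight-one lemmas of
`Literature/Algebra/Lie/Sl2WeightOne`. [cite: Bump1997, Thm. 2.5.4 (ii)] -/
theorem sl2Casimir_apply_of_hasHCParameter (h : HasHCParameter ρ fun _ ↦ ({0, 0} : Multiset ℂ))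
    (v : V) : Literature.Algebra.Lie.Sl2.casimir (H ρ) (R ρ) (L ρ) v = (-1 : ℂ) • v := by
  rw [sl2Casimir_eq_lift_casimir, lift_casimir_eq_neg_one_of_hasHCParameter ρ h]
  simp

end GL2Real

end Literature.NumberTheory.Automorphic

end
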